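import Mathlib.MeasureTheory.Measure.Hausdorff
import Mathlib.MeasureTheory.Covering.Vitali
import Mathlib.MeasureTheory.Measure.Regular
import Mathlib.MeasureTheory.Integral.Lebesgue.Add
import Mathlib.Analysis.SpecialFunctions.Sqrt
import Mathlib.Analysis.SpecialFunctions.Pow.NNReal
import Mathlib.Analysis.SpecificLimits.Basic
import Literature.Analysis.FluidPDE.NSLerayHopf
import Literature.Analysis.FluidPDE.LerayLocalRegularH1
import HarnessLib

/-!
# Scheffer's theorem on the singular times of a Leray–Hopf solution: reduction to Leray's
  structure theorem

Companion ("proofs") file of `Literature/Analysis/FluidPDE/NSLerayHopf.lean` for the named fact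
`Literature.Analysis.FluidPDE.scheffer_singular_times` (**ns.S28**: the singular times of a
Leray–Hopf weak solution of the unforced Navier–Stokes system on `ℝ³ × [0, T₀)` form an
`ℋ^{1/2}`-null set; Leray 1934, §34; Scheffer 1976; Robinson–Rodrigo–Sadowski 2016, Thm. 8.14).

The printed proof has two layers of very different nature:

* **(PDE input) Leray's structure theorem** (Leray 1934, §33 "Théorème de structure" with the
  existence time (4.3) of §24 and the definition of regular solutions of §15): almost every
  epoch `t' ∈ (0, T₀)` of a turbulent (= Leray–Hopf) solution `u` is the origin of an interval of
  time of length at least `A ν³ J(t')⁻⁴`, `J(t')² = ∫ |∇u(t')|²`, in the interior of which `u`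
  coincides with a *regular* solution, in particular is bounded on every compact sub-strip, so
  that every space–time point over that open interval is a regular point.  This layer is kept as
  an explicit *hypothesis* of the reduction (no `def`, no new named fact) and is **proved** from
  the accepted leaf `leray_local_regular_H1` of `LerayLocalRegularH1.lean` (Leray's local regular
  solutions issued from `H¹` data, Leray 1934, §§19–24; Ożański–Pooley 2018, Thm. 6.30, Cor. 6.16)
  together with the proved restart (`Fluid.IsLerayHopfOn.ae_isLerayHopfOn_restart`) and
  weak–strong uniqueness (`serrin_weak_strong_uniqueness_holds`) theorems of the tree:
  `LerayLocalRegularH1With.leray_structure`.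
* **(covering argument) Leray 1934, §34, (6.5) / Scheffer 1976 / Robinson–Rodrigo–Sadowski 2016,
  proof of Thm. 8.14**: if `t` is a singular time then, for a.e. earlier `t'`,
  `J(t')² ≥ (A ν³)^{1/2} (t - t')^{-1/2}`, whence `∫_{t-ρ}^{t} J² ≥ (A ν³)^{1/2} √ρ`; a Vitali
  covering of the singular set by such intervals inside an open set of small `∫ J²` then shows
  that the `ℋ^{1/2}`-measure of the singular times vanishes (first that its Lebesgue measure
  vanishes, then, by absolute continuity of `∫ J²`, the `ℋ^{1/2}` statement).  This layer is
  **proved** here in full, abstractly (`hausdorffMeasure_half_eq_zero_of_sqrt_rate`) and then for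
  Navier–Stokes (`scheffer_singular_times_of_leray_structure`).

Net effect: `scheffer_singular_times ⇐ leray_local_regular_H1`
(`scheffer_singular_times_of_leray_local_regular_H1`, sorry-free, axioms `propext`,
`Classical.choice`, `Quot.sound`); the discharge `scheffer_singular_times_holds` is exactly one
application away from a future `leray_local_regular_H1_holds`. No new unproved fact is introduced.

## Contents

* `exists_vitali_cover_of_sqrt_rate` — the covering step: a countable disjointed Vitali family of
  intervals `[b - ρ_b, b + ρ_b]`, `ρ_b ≤ δ`, whose five-fold enlargements cover `N` and with
  `C ∑ √ρ_b ≤ ∫_O g` (real proof, Mathlib's Vitali covering lemma).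
* `hausdorffMeasure_half_eq_zero_of_sqrt_rate` — **the Leray–Scheffer covering lemma**: a set
  `N ⊆ U` of reals such that every `t ∈ N` satisfies `C √ρ ≤ ∫_{t-ρ}^{t} g` for all small `ρ`,
  with `∫_U g < ∞`, is `ℋ^{1/2}`-null (real proof).
* `leray_rate_of_regular_intervals` — Leray's rate `A ν³ ≤ (T - t') J(t')⁴` before a singular
  time `T` (real proof from the structure theorem's conclusion).
* `scheffer_singular_times_of_leray_structure` — Leray's structure theorem (as a hypothesis, with
  constant `A`) `→ scheffer_singular_times` (real proof).
* `uncurry_ae_eq_restrict_prod_of_forall_slice_ae_eq` — Fubini upgrade of slice-wise a.e.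
  equality on a time slab (real proof).
* `LerayLocalRegularH1With.leray_structure` — Leray's structure theorem with the lifespan
  constant of `LerayLocalRegularH1With c` (real proof).
* `scheffer_singular_times_of_leray_local_regular_H1` — `leray_local_regular_H1 →
  scheffer_singular_times` (real proof).

## Mathlib search

Used from Mathlib: `Vitali.exists_disjoint_subfamily_covering_enlargement_closedBall`,
`Set.PairwiseDisjoint.countable_of_nonempty_interior`,
`MeasureTheory.Measure.hausdorffMeasure_le_liminf_tsum`, `MeasureTheory.hausdorffMeasure_real`
(`μH[1] = volume` on `ℝ`), `MeasureTheory.exists_pos_setLIntegral_lt_of_measure_lt` (absolute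
continuity of `∫⁻`), `Set.exists_isOpen_lt_of_lt` (outer regularity), `Real.ediam_Icc`.
Mathlib has no statement combining them (searched `hausdorffMeasure` + `Vitali`: none).

## References

* J. Leray, *Sur le mouvement d'un liquide visqueux emplissant l'espace*, Acta Math. 63 (1934),
  193–248: §15 p. 217 (regular solutions: `V(t) = max |u|` below a continuous function),
  §24 (4.3) p. 229 (`τ = A ν³ J⁻⁴(0)`), §31 p. 240–241 (turbulent solutions), §33 p. 244–245
  (Théorème de structure), §34 p. 246 (`J(t') > A₁ ν^{3/4} (T_l - t')^{-1/4}`, (6.5)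
  `2 A₁² ν^{5/2} ∑' √(T_l - Θ_l) < ½ W(0)`).
* V. Scheffer, *Turbulence and Hausdorff dimension*, in: Turbulence and Navier–Stokes equations
  (Orsay 1975), Lecture Notes in Math. 565, Springer (1976), 174–183.
* J. C. Robinson, J. L. Rodrigo, W. Sadowski, *The three-dimensional Navier–Stokes equations*,
  CUP (2016), Def. 8.2, Thm. 8.13, Thm. 8.14 and its proof, Lemma 6.11 (proof), Lemma 8.4, §8.6
  and Notes p. 176–177.
* W. S. Ożański, B. C. Pooley, *Leray's fundamental work on the Navier–Stokes equations: a modern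
  review*, LMS Lecture Notes 452, CUP (2018), Thm. 6.30, Cor. 6.16 (the leaf
  `leray_local_regular_H1`).
-/

noncomputable section

open MeasureTheory TopologicalSpace Set Function Filter Metric Topology
open scoped ENNReal NNReal

namespace Literature.Analysis.FluidPDE

/-! ### The Leray–Scheffer covering lemma on the real line -/

section Covering

/-- **Covering step** (Robinson–Rodrigo–Sadowski 2016, proof of Thm. 8.14, made effective by a
Vitali covering instead of the compactness of the singular set). Let `N ⊆ O ⊆ ℝ` with `O` open and
suppose that every `t ∈ N` satisfies `C √ρ ≤ ∫_{(t-ρ, t)} g` for all sufficiently small `ρ > 0`.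
Then for every `δ > 0` there are a countable set `u ⊆ ℝ` and radii `0 < ρ_b ≤ δ` (`b ∈ u`) such
that the intervals `[b - 5ρ_b, b + 5ρ_b]` cover `N` and `C ∑_{b ∈ u} √ρ_b ≤ ∫_O g` (the intervals
`(b - ρ_b, b)` being pairwise disjoint and contained in `O`). [cite: RobinsonRodrigoSadowskiCUP2016, Thm. 8.14 (proof)] -/
theorem exists_vitali_cover_of_sqrt_rate {N O : Set ℝ} (hO : IsOpen O) (hNO : N ⊆ O)
    {g : ℝ → ℝ≥0∞} {C : ℝ≥0∞}
    (hrate : ∀ t ∈ N, ∃ ρ₀ > 0, ∀ ρ ∈ Ioo 0 ρ₀,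
      C * ENNReal.ofReal (Real.sqrt ρ) ≤ ∫⁻ s in Ioo (t - ρ) t, g s)
    {δ : ℝ} (hδ : 0 < δ) :
    ∃ u : Set ℝ, u.Countable ∧ ∃ ρ : ℝ → ℝ, (∀ b ∈ u, 0 < ρ b ∧ ρ b ≤ δ) ∧
      N ⊆ ⋃ b ∈ u, closedBall b (5 * ρ b) ∧
      C * ∑' b : u, ENNReal.ofReal (Real.sqrt (ρ b)) ≤ ∫⁻ s in O, g s := by
  -- choice of an admissible radius at every point of `N`
  have hchoice : ∀ t ∈ N, ∃ ρ : ℝ, 0 < ρ ∧ ρ ≤ δ ∧ closedBall t ρ ⊆ O ∧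
      C * ENNReal.ofReal (Real.sqrt ρ) ≤ ∫⁻ s in Ioo (t - ρ) t, g s := by
    intro t ht
    obtain ⟨ρ₀, hρ₀, hr⟩ := hrate t ht
    obtain ⟨ε, hε, hεO⟩ := Metric.isOpen_iff.1 hO t (hNO ht)
    refine ⟨min (min δ (ρ₀ / 2)) (ε / 2), by positivity,
      (min_le_left _ _).trans (min_le_left _ _), ?_, hr _ ⟨by positivity, ?_⟩⟩
    · refine (closedBall_subset_ball ?_).trans hεO
      exact (min_le_right _ _).trans_lt (by linarith)
    · exact ((min_le_left _ _).trans (min_le_right _ _)).trans_lt (by linarith)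
  choose! ρ hρpos hρδ hρO hρint using hchoice
  -- Vitali's covering lemma
  obtain ⟨u, huN, hdisj, hcover⟩ :=
    Vitali.exists_disjoint_subfamily_covering_enlargement_closedBall N id ρ δ
      (fun a ha => hρδ a ha) 5 (by norm_num)
  have hucount : u.Countable :=
    hdisj.countable_of_nonempty_interior fun b hb =>
      ⟨b, ball_subset_interior_closedBall (mem_ball_self (hρpos b (huN hb)))⟩
  refine ⟨u, hucount, ρ, fun b hb => ⟨hρpos b (huN hb), hρδ b (huN hb)⟩, ?_, ?_⟩
  · intro t ht
    obtain ⟨b, hb, hsub⟩ := hcover t ht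
    exact mem_biUnion hb (hsub (mem_closedBall_self (hρpos t ht).le))
  · haveI : Countable u := hucount.to_subtype
    have hIoo : ∀ b : ℝ, Ioo (b - ρ b) b ⊆ closedBall b (ρ b) := fun b s hs => by
      rw [Real.closedBall_eq_Icc]
      exact ⟨hs.1.le, by linarith [hs.1, hs.2]⟩
    have hdisj' : Pairwise (Disjoint on fun b : u => Ioo ((b : ℝ) - ρ b) b) := by
      intro b b' hbb'
      have h : Disjoint (closedBall (id (b : ℝ)) (ρ b)) (closedBall (id (b' : ℝ)) (ρ b')) :=
        hdisj b.2 b'.2 (Subtype.coe_injective.ne hbb')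
      exact h.mono (hIoo b) (hIoo b')
    calc C * ∑' b : u, ENNReal.ofReal (Real.sqrt (ρ b))
        = ∑' b : u, C * ENNReal.ofReal (Real.sqrt (ρ b)) := ENNReal.tsum_mul_left.symm
      _ ≤ ∑' b : u, ∫⁻ s in Ioo ((b : ℝ) - ρ b) b, g s :=
          ENNReal.tsum_le_tsum fun b => hρint b (huN b.2)
      _ = ∫⁻ s in ⋃ b : u, Ioo ((b : ℝ) - ρ b) b, g s :=
          (lintegral_iUnion (fun _ => measurableSet_Ioo) hdisj' g).symm
      _ ≤ ∫⁻ s in O, g s :=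
          lintegral_mono_set (iUnion_subset fun b => (hIoo b).trans (hρO b (huN b.2)))

/-- **The Leray–Scheffer covering lemma** (Leray 1934, §34, (6.5); Scheffer 1976;
Robinson–Rodrigo–Sadowski 2016, Thm. 8.13–8.14, abstract form of the proofs). Let `U ⊆ ℝ` be open,
`g : ℝ → [0, ∞]` with `∫_U g < ∞`, `0 < C < ∞`, and let `N ⊆ U` be a set every point `t` of which
satisfies the square-root rate `C √ρ ≤ ∫_{(t-ρ, t)} g` for all sufficiently small `ρ > 0`. Then
`ℋ^{1/2}(N) = 0`. (First `|N| = 0` by a Vitali cover with `∑ 10ρ_b ≤ 10 √δ ∑ √ρ_b ≤ 10 √δ ∫_U g / C`;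
then, covering inside open sets `O ⊇ N` with `∫_O g → 0`, `∑ (10 ρ_b)^{1/2} ≤ √10 ∫_O g / C → 0`.)
[cite: RobinsonRodrigoSadowskiCUP2016, Thm. 8.14 (proof)] -/
theorem hausdorffMeasure_half_eq_zero_of_sqrt_rate {N U : Set ℝ} (hU : IsOpen U) (hNU : N ⊆ U)
    {g : ℝ → ℝ≥0∞} (hg : ∫⁻ s in U, g s ≠ ∞) {C : ℝ≥0∞} (hC : C ≠ 0) (hC' : C ≠ ∞)
    (hrate : ∀ t ∈ N, ∃ ρ₀ > 0, ∀ ρ ∈ Ioo 0 ρ₀,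
      C * ENNReal.ofReal (Real.sqrt ρ) ≤ ∫⁻ s in Ioo (t - ρ) t, g s) :
    μH[(1 / 2 : ℝ)] N = 0 := by
  -- a sequence of scales
  set δ : ℕ → ℝ := fun n => 1 / ((n : ℝ) + 1)
  have hδpos : ∀ n, 0 < δ n := fun n => Nat.one_div_pos_of_nat
  have hδlim : Tendsto δ atTop (𝓝 0) := tendsto_one_div_add_atTop_nhds_zero_nat
  have hsqrtδlim : Tendsto (fun n => Real.sqrt (δ n)) atTop (𝓝 0) := by
    have h := hδlim.sqrt
    rwa [Real.sqrt_zero] at h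
  have hrlim : Tendsto (fun n => ENNReal.ofReal (10 * δ n)) atTop (𝓝 0) := by
    have h := ENNReal.tendsto_ofReal (hδlim.const_mul 10)
    rwa [mul_zero, ENNReal.ofReal_zero] at h
  -- the diameter of the enlarged Vitali intervals
  have hdiam : ∀ (b r : ℝ), Metric.ediam (closedBall b (5 * r)) = ENNReal.ofReal (10 * r) := by
    intro b r
    rw [Real.closedBall_eq_Icc, Real.ediam_Icc]
    congr 1
    ring
  -- Step 1: `N` is Lebesgue-null.
  have hN0 : volume N = 0 := by
    have hcov : ∀ n : ℕ, ∃ u : Set ℝ, u.Countable ∧ ∃ ρ : ℝ → ℝ, (∀ b ∈ u, 0 < ρ b ∧ ρ b ≤ δ n) ∧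
        N ⊆ ⋃ b ∈ u, closedBall b (5 * ρ b) ∧
        C * ∑' b : u, ENNReal.ofReal (Real.sqrt (ρ b)) ≤ ∫⁻ s in U, g s := fun n =>
      exists_vitali_cover_of_sqrt_rate hU hNU hrate (hδpos n)
    choose u hu ρ hρ hcover hsum using hcov
    haveI : ∀ n, Countable (u n) := fun n => (hu n).to_subtype
    have hle := MeasureTheory.Measure.hausdorffMeasure_le_liminf_tsum 1 N
      (l := atTop) (fun n => ENNReal.ofReal (10 * δ n)) hrlim
      (fun n (b : u n) => closedBall (b : ℝ) (5 * ρ n b))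
      (Eventually.of_forall fun n b => by
        rw [hdiam]
        exact ENNReal.ofReal_le_ofReal (by linarith [(hρ n b b.2).2]))
      (Eventually.of_forall fun n => by simpa only [iUnion_coe_set] using hcover n)
    -- bound on the sums
    have hbound : ∀ n, (∑' b : u n, Metric.ediam (closedBall (b : ℝ) (5 * ρ n b)) ^ (1 : ℝ)) ≤
        ENNReal.ofReal (10 * Real.sqrt (δ n)) * ((∫⁻ s in U, g s) / C) := by
      intro n
      have h1 : ∀ b : u n, Metric.ediam (closedBall (b : ℝ) (5 * ρ n b)) ^ (1 : ℝ) ≤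
          ENNReal.ofReal (10 * Real.sqrt (δ n)) * ENNReal.ofReal (Real.sqrt (ρ n b)) := by
        intro b
        obtain ⟨hb0, hbδ⟩ := hρ n b b.2
        rw [ENNReal.rpow_one, hdiam, ← ENNReal.ofReal_mul (by positivity)]
        refine ENNReal.ofReal_le_ofReal ?_
        have hs : Real.sqrt (ρ n b) * Real.sqrt (ρ n b) = ρ n b := Real.mul_self_sqrt hb0.le
        have hs' : Real.sqrt (ρ n b) ≤ Real.sqrt (δ n) := Real.sqrt_le_sqrt hbδ
        nlinarith [Real.sqrt_nonneg (ρ n b), Real.sqrt_nonneg (δ n)]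
      calc (∑' b : u n, Metric.ediam (closedBall (b : ℝ) (5 * ρ n b)) ^ (1 : ℝ))
          ≤ ∑' b : u n, ENNReal.ofReal (10 * Real.sqrt (δ n)) *
              ENNReal.ofReal (Real.sqrt (ρ n b)) := ENNReal.tsum_le_tsum h1
        _ = ENNReal.ofReal (10 * Real.sqrt (δ n)) *
              ∑' b : u n, ENNReal.ofReal (Real.sqrt (ρ n b)) := ENNReal.tsum_mul_left
        _ ≤ ENNReal.ofReal (10 * Real.sqrt (δ n)) * ((∫⁻ s in U, g s) / C) := by
          gcongr
          rw [ENNReal.le_div_iff_mul_le (Or.inl hC) (Or.inl hC'), mul_comm]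
          exact hsum n
    have hlim : Tendsto (fun n => ENNReal.ofReal (10 * Real.sqrt (δ n)) * ((∫⁻ s in U, g s) / C))
        atTop (𝓝 0) := by
      have h0 : Tendsto (fun n => ENNReal.ofReal (10 * Real.sqrt (δ n))) atTop (𝓝 0) := by
        have h := ENNReal.tendsto_ofReal (hsqrtδlim.const_mul 10)
        rwa [mul_zero, ENNReal.ofReal_zero] at h
      have h := ENNReal.Tendsto.mul_const h0 (Or.inr (ENNReal.div_ne_top hg hC))
      rwa [zero_mul] at h
    rw [← MeasureTheory.hausdorffMeasure_real]
    refine nonpos_iff_eq_zero.1 ?_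
    calc μH[1] N ≤ liminf (fun n => ∑' b : u n,
          Metric.ediam (closedBall (b : ℝ) (5 * ρ n b)) ^ (1 : ℝ)) atTop := hle
      _ ≤ liminf (fun n => ENNReal.ofReal (10 * Real.sqrt (δ n)) * ((∫⁻ s in U, g s) / C))
          atTop := liminf_le_liminf (Eventually.of_forall hbound)
      _ = 0 := hlim.liminf_eq
  -- Step 2: open sets `O ⊇ N` with `∫_O g` small.
  have hsmall : ∀ n : ℕ, ∃ O : Set ℝ, IsOpen O ∧ N ⊆ O ∧ ∫⁻ s in O, g s ≤ ((n : ℝ≥0∞) + 1)⁻¹ := by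
    intro n
    have hε : ((n : ℝ≥0∞) + 1)⁻¹ ≠ 0 := ENNReal.inv_ne_zero.2 (by simp)
    obtain ⟨η, hη, hηint⟩ :=
      exists_pos_setLIntegral_lt_of_measure_lt (μ := volume.restrict U) hg hε
    obtain ⟨O, hNO, hO, hOη⟩ :=
      N.exists_isOpen_lt_of_lt (μ := volume) η (by rw [hN0]; exact hη)
    refine ⟨O ∩ U, hO.inter hU, subset_inter hNO hNU, ?_⟩
    have h1 : (volume.restrict U) O < η := by
      rw [Measure.restrict_apply hO.measurableSet]
      exact (measure_mono inter_subset_left).trans_lt hOη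
    have h2 := hηint O h1
    rw [Measure.restrict_restrict hO.measurableSet] at h2
    exact h2.le
  choose O hO hNO hOint using hsmall
  have hcov : ∀ n : ℕ, ∃ u : Set ℝ, u.Countable ∧ ∃ ρ : ℝ → ℝ, (∀ b ∈ u, 0 < ρ b ∧ ρ b ≤ δ n) ∧
      N ⊆ ⋃ b ∈ u, closedBall b (5 * ρ b) ∧
      C * ∑' b : u, ENNReal.ofReal (Real.sqrt (ρ b)) ≤ ∫⁻ s in O n, g s := fun n =>
    exists_vitali_cover_of_sqrt_rate (hO n) (hNO n) hrate (hδpos n)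
  choose u hu ρ hρ hcover hsum using hcov
  haveI : ∀ n, Countable (u n) := fun n => (hu n).to_subtype
  have hle := MeasureTheory.Measure.hausdorffMeasure_le_liminf_tsum (1 / 2) N
    (l := atTop) (fun n => ENNReal.ofReal (10 * δ n)) hrlim
    (fun n (b : u n) => closedBall (b : ℝ) (5 * ρ n b))
    (Eventually.of_forall fun n b => by
      rw [hdiam]
      exact ENNReal.ofReal_le_ofReal (by linarith [(hρ n b b.2).2]))
    (Eventually.of_forall fun n => by simpa only [iUnion_coe_set] using hcover n)
  have hbound : ∀ n, (∑' b : u n,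
      Metric.ediam (closedBall (b : ℝ) (5 * ρ n b)) ^ (1 / 2 : ℝ)) ≤
      ENNReal.ofReal (Real.sqrt 10) * (((n : ℝ≥0∞) + 1)⁻¹ / C) := by
    intro n
    have h1 : ∀ b : u n, Metric.ediam (closedBall (b : ℝ) (5 * ρ n b)) ^ (1 / 2 : ℝ) =
        ENNReal.ofReal (Real.sqrt 10) * ENNReal.ofReal (Real.sqrt (ρ n b)) := by
      intro b
      obtain ⟨hb0, -⟩ := hρ n b b.2
      rw [hdiam, ENNReal.ofReal_rpow_of_nonneg (by positivity) (by norm_num),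
        ← ENNReal.ofReal_mul (Real.sqrt_nonneg _), ← Real.sqrt_mul (by norm_num : (0 : ℝ) ≤ 10),
        Real.sqrt_eq_rpow]
    calc (∑' b : u n, Metric.ediam (closedBall (b : ℝ) (5 * ρ n b)) ^ (1 / 2 : ℝ))
        = ∑' b : u n, ENNReal.ofReal (Real.sqrt 10) * ENNReal.ofReal (Real.sqrt (ρ n b)) :=
          tsum_congr h1
      _ = ENNReal.ofReal (Real.sqrt 10) * ∑' b : u n, ENNReal.ofReal (Real.sqrt (ρ n b)) :=
          ENNReal.tsum_mul_left
      _ ≤ ENNReal.ofReal (Real.sqrt 10) * (((n : ℝ≥0∞) + 1)⁻¹ / C) := by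
          gcongr
          rw [ENNReal.le_div_iff_mul_le (Or.inl hC) (Or.inl hC'), mul_comm]
          exact (hsum n).trans (hOint n)
  have hlim : Tendsto (fun n : ℕ => ENNReal.ofReal (Real.sqrt 10) * (((n : ℝ≥0∞) + 1)⁻¹ / C))
      atTop (𝓝 0) := by
    have h0 : Tendsto (fun n : ℕ => ((n : ℝ≥0∞) + 1)⁻¹) atTop (𝓝 0) := by
      have h := ENNReal.tendsto_inv_nat_nhds_zero.comp (tendsto_add_atTop_nat 1)
      simpa [Function.comp_def, Nat.cast_add, Nat.cast_one] using h
    have h1 : Tendsto (fun n : ℕ => ((n : ℝ≥0∞) + 1)⁻¹ / C) atTop (𝓝 0) := by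
      have h := ENNReal.Tendsto.const_mul h0 (Or.inr (ENNReal.inv_ne_top.2 hC))
      rw [mul_zero] at h
      simpa only [ENNReal.div_eq_inv_mul] using h
    have h := ENNReal.Tendsto.const_mul (a := ENNReal.ofReal (Real.sqrt 10)) h1
      (Or.inr ENNReal.ofReal_ne_top)
    rwa [mul_zero] at h
  refine nonpos_iff_eq_zero.1 ?_
  calc μH[(1 / 2 : ℝ)] N ≤ liminf (fun n => ∑' b : u n,
        Metric.ediam (closedBall (b : ℝ) (5 * ρ n b)) ^ (1 / 2 : ℝ)) atTop := hle
    _ ≤ liminf (fun n : ℕ => ENNReal.ofReal (Real.sqrt 10) * (((n : ℝ≥0∞) + 1)⁻¹ / C)) atTop :=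
        liminf_le_liminf (Eventually.of_forall hbound)
    _ = 0 := hlim.liminf_eq

end Covering

/-! ### Leray's structure theorem and the reduction of Scheffer's theorem

**Leray's structure theorem: epochs of regularity of a turbulent solution** (Leray 1934, Acta
Math. 63: §33, p. 244, "Théorème de structure" and the paragraph preceding it — *"Soit une époque
non singulière, c'est-à-dire choisie hors d'un certain ensemble de mesure nulle: cette époque est
l'origine d'un intervalle de temps à l'intérieur duquel la solution turbulente envisagée coïncide
avec une solution régulière des équations de Navier; et cette coïncidence ne cesse pas tant que
cette solution régulière n'est pas devenue irrégulière"* — combined with the existence time (4.3),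
p. 229, `τ = A ν³ J⁻⁴(0)` of the (semi-)regular solution issued from a state with square-summable
quasi-derivatives (§24), as used in §34, p. 246: `J(t') > A₁ ν^{3/4} (T_l - t')^{-1/4}` for a
non-singular `t'` and a later end `T_l` of an interval of regularity; and with the definition of
regular solutions, §15, p. 217: on an interval of regularity `V(t) = max_x |u(x, t)|` stays below a
continuous function of `t`, so that `u` is bounded on every compact sub-strip. Modern account
(torus): Robinson–Rodrigo–Sadowski 2016, Lemma 8.4 and Thm. 8.14, built on Thm. 6.8 / Lemma 6.11
(local strong solutions, `T ≥ c ν³ ‖∇u₀‖⁻⁴`) and Thm. 6.10 (weak–strong uniqueness); whole space: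
§8.6 and Notes, p. 176.)

**The form used below** ("structure hypothesis with constant `A`"). If `ν > 0` and `u` is a
Leray–Hopf weak solution of the unforced Navier–Stokes system on `ℝ³ × [0, T₀)` with datum `u₀`
(accepted `Fluid.IsLerayHopfOn`, Leray–Hopf in the strict sense: energy inequality from a.e. time),
then there is a weak gradient `G` of `u` (a.e. in time, `∇u = G ∈ L²((0, T₀) × ℝ³)`, as in the
definition) such that for a.e. `t' ∈ (0, T₀)`: every time `t ∈ (t', T₀)` with
`(t - t') · J(t')⁴ < A ν³`, where `J(t')² = ∫ |G(t')|²` (Leray's `J²(t')`, the quasi-derivatives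
being the weak gradient), is a totally regular time of `u` — every space–time point `(t, x)` is a
regular point (accepted `Fluid.IsRegularPoint`: `u` essentially bounded on a parabolic cylinder
about `(t, x)`). The product form `(t - t') J⁴ < A ν³` of `t - t' < A ν³ J⁻⁴` avoids division
(`J(t') = 0` gives the whole interval `(t', T₀)`, as it should: then `u(t') = 0` and `u ≡ 0`
afterwards). This hypothesis is **proved** below from the accepted leaf `leray_local_regular_H1`,
with `A` the leaf's lifespan constant (`LerayLocalRegularH1With.leray_structure`); no `def` is
introduced for it. -/


/-- **Leray's rate at a singular time** (Leray 1934, §34, p. 246, first display: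
`J(t') > A₁ ν^{3/4} (T_l - t')^{-1/4}`; Robinson–Rodrigo–Sadowski 2016, Lemma 6.11 / proof of
Thm. 8.13). Under the conclusion of Leray's structure theorem with constant `A` (module docstring
of this section): if `T < T₀` is a singular time of `u` (accepted `Fluid.IsSingularTime`), then for
a.e. `t' ∈ (0, T₀)` with `t' < T` one has `A ν³ ≤ (T - t') · J(t')⁴`, i.e.
`J(t')² ≥ (A ν³)^{1/2} (T - t')^{-1/2}` (contrapositive: otherwise every `(T, x)` would be a regular
point). Real proof. [cite: Leray1934, §34 p. 246] -/
theorem leray_rate_of_regular_intervals {A ν T₀ : ℝ} {u : ℝ → (EuclideanSpace ℝ (Fin 3)) → (EuclideanSpace ℝ (Fin 3))}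
    {G : ℝ → (EuclideanSpace ℝ (Fin 3)) → (EuclideanSpace ℝ (Fin 3)) →L[ℝ] (EuclideanSpace ℝ (Fin 3))}
    (hreg : ∀ᵐ t' ∂(volume.restrict (Ioo 0 T₀)), ∀ t ∈ Ioo t' T₀,
        ENNReal.ofReal (t - t') * (∫⁻ x, ENNReal.ofReal (FluidPDE.frobeniusNormSq (G t' x))) ^ 2 <
            ENNReal.ofReal (A * ν ^ 3) →
          ∀ x : (EuclideanSpace ℝ (Fin 3)), FluidPDE.IsRegularPoint u (t, x))
    {T : ℝ} (hT : T < T₀) (hsing : FluidPDE.IsSingularTime u T) :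
    ∀ᵐ t' ∂(volume.restrict (Ioo 0 T₀)), t' < T →
      ENNReal.ofReal (A * ν ^ 3) ≤
        ENNReal.ofReal (T - t') *
          (∫⁻ x, ENNReal.ofReal (FluidPDE.frobeniusNormSq (G t' x))) ^ 2 := by
  filter_upwards [hreg] with t' ht' ht'T
  by_contra h
  obtain ⟨x, hx⟩ := hsing
  exact hx (ht' T ⟨ht'T, hT⟩ (not_le.1 h) x)

/-- **Scheffer's theorem from Leray's structure theorem** (Leray 1934, §34, (6.5):
`2 A₁² ν^{5/2} ∑' √(T_l - Θ_l) < ½ W(0)`; Scheffer 1976; Robinson–Rodrigo–Sadowski 2016, Thm. 8.14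
and its proof). Granted Leray's structure theorem with some constant `A > 0` (the hypothesis
`hstruct`, module docstring of this section), the singular times in `(0, T₀)` of every Leray–Hopf
weak solution of the unforced Navier–Stokes system on `ℝ³ × [0, T₀)` form an `ℋ^{1/2}`-null set:
the accepted statement `scheffer_singular_times`. Real proof: at a singular time `T`, Leray's rate
gives `∫_{(T-ρ, T)} J² ≥ (A ν³)^{1/2} √ρ` for `0 < ρ < T` (the integrand is a.e.
`≥ (A ν³)^{1/2} ρ^{-1/2}` there), and the Leray–Scheffer covering lemma
`hausdorffMeasure_half_eq_zero_of_sqrt_rate` applies with `g = J² ∈ L¹(0, T₀)`. [cite: Leray1934, §34 (6.5) p. 246] [cite: Scheffer1976] [cite: RobinsonRodrigoSadowskiCUP2016, Thm. 8.14] -/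
theorem scheffer_singular_times_of_leray_structure {A : ℝ} (hA : 0 < A)
    (hstruct : ∀ {ν T₀ : ℝ} (_hν : 0 < ν) (_hT₀ : 0 < T₀) {u₀ : (EuclideanSpace ℝ (Fin 3)) → (EuclideanSpace ℝ (Fin 3))} {u : ℝ → (EuclideanSpace ℝ (Fin 3)) → (EuclideanSpace ℝ (Fin 3))}
      (_hu : FluidPDE.IsLerayHopfOn T₀ ν 0 u₀ u),
      ∃ G : ℝ → (EuclideanSpace ℝ (Fin 3)) → (EuclideanSpace ℝ (Fin 3)) →L[ℝ] (EuclideanSpace ℝ (Fin 3)),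
        (∀ᵐ t ∂(volume.restrict (Ioo 0 T₀)), FluidPDE.HasWeakGradient (u t) (G t)) ∧
        (∫⁻ t in Ioo 0 T₀, ∫⁻ x, ENNReal.ofReal (FluidPDE.frobeniusNormSq (G t x)) < ∞) ∧
        ∀ᵐ t' ∂(volume.restrict (Ioo 0 T₀)), ∀ t ∈ Ioo t' T₀,
          ENNReal.ofReal (t - t') *
              (∫⁻ x, ENNReal.ofReal (FluidPDE.frobeniusNormSq (G t' x))) ^ 2 <
                ENNReal.ofReal (A * ν ^ 3) →
            ∀ x : (EuclideanSpace ℝ (Fin 3)), FluidPDE.IsRegularPoint u (t, x)) :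
    scheffer_singular_times := by
  intro ν T₀ hν hT₀ u₀ u hu
  obtain ⟨G, -, hGint, hreg⟩ := hstruct hν hT₀ hu
  set J : ℝ → ℝ≥0∞ := fun t => ∫⁻ x, ENNReal.ofReal (FluidPDE.frobeniusNormSq (G t x))
  have hAν : 0 < A * ν ^ 3 := by positivity
  set c : ℝ := Real.sqrt (A * ν ^ 3)
  have hcpos : 0 < c := Real.sqrt_pos.2 hAν
  refine hausdorffMeasure_half_eq_zero_of_sqrt_rate
    (N := {T ∈ Ioo 0 T₀ | FluidPDE.IsSingularTime u T}) (U := Ioo 0 T₀) (g := J)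
    (C := ENNReal.ofReal c) isOpen_Ioo (fun T hT => hT.1) hGint.ne
    (by simpa using hcpos) ENNReal.ofReal_ne_top ?_
  rintro T ⟨⟨hT0, hTT₀⟩, hsing⟩
  refine ⟨T, hT0, fun ρ hρ => ?_⟩
  obtain ⟨hρ0, hρT⟩ := hρ
  have hsub : Ioo (T - ρ) T ⊆ Ioo 0 T₀ := Ioo_subset_Ioo (by linarith) hTT₀.le
  -- Leray's rate, a.e. on `(T - ρ, T)`, in the form `c √ρ ≤ ρ J(t')²`
  have hrate : ∀ᵐ t' ∂(volume.restrict (Ioo (T - ρ) T)),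
      ENNReal.ofReal c * ENNReal.ofReal (Real.sqrt ρ) ≤ ENNReal.ofReal ρ * J t' := by
    have h1 := ae_restrict_of_ae_restrict_of_subset hsub
      (leray_rate_of_regular_intervals hreg hTT₀ hsing)
    have h2 : ∀ᵐ t' ∂(volume.restrict (Ioo (T - ρ) T)), t' ∈ Ioo (T - ρ) T :=
      ae_restrict_mem measurableSet_Ioo
    filter_upwards [h1, h2] with t' ht' hmem
    have hle : ENNReal.ofReal (A * ν ^ 3) ≤ ENNReal.ofReal ρ * J t' ^ 2 :=
      (ht' hmem.2).trans
        (mul_le_mul_left (ENNReal.ofReal_le_ofReal (by linarith [hmem.1])) _)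
    -- pass to real numbers
    rcases eq_or_ne (J t') ∞ with hJtop | hJtop
    · rw [hJtop, ENNReal.mul_top (by simpa using hρ0)]
      exact le_top
    · set y : ℝ := (J t').toReal
      have hyJ : J t' = ENNReal.ofReal y := (ENNReal.ofReal_toReal hJtop).symm
      have hy0 : 0 ≤ y := ENNReal.toReal_nonneg
      rw [hyJ] at hle ⊢
      rw [← ENNReal.ofReal_pow hy0, ← ENNReal.ofReal_mul hρ0.le,
        ENNReal.ofReal_le_ofReal_iff (mul_nonneg hρ0.le (sq_nonneg y))] at hle
      rw [← ENNReal.ofReal_mul hcpos.le, ← ENNReal.ofReal_mul hρ0.le]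
      refine ENNReal.ofReal_le_ofReal ?_
      -- `c √ρ ≤ ρ y` from `c = √(A ν³) ≤ √(ρ y²) = √ρ y`
      have hsρ : Real.sqrt ρ * Real.sqrt ρ = ρ := Real.mul_self_sqrt hρ0.le
      have hkey : c ≤ Real.sqrt ρ * y :=
        calc c = Real.sqrt (A * ν ^ 3) := rfl
          _ ≤ Real.sqrt (ρ * y ^ 2) := Real.sqrt_le_sqrt hle
          _ = Real.sqrt ρ * y := by rw [Real.sqrt_mul hρ0.le, Real.sqrt_sq hy0]
      calc c * Real.sqrt ρ ≤ Real.sqrt ρ * y * Real.sqrt ρ :=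
            mul_le_mul_of_nonneg_right hkey (Real.sqrt_nonneg _)
        _ = ρ * y := by rw [mul_right_comm, hsρ]
  -- integrate the rate over `(T - ρ, T)`
  have hvol : volume (Ioo (T - ρ) T) = ENNReal.ofReal ρ := by
    rw [Real.volume_Ioo]
    congr 1
    ring
  have hint : ENNReal.ofReal ρ * (ENNReal.ofReal c * ENNReal.ofReal (Real.sqrt ρ)) ≤
      ENNReal.ofReal ρ * ∫⁻ s in Ioo (T - ρ) T, J s := by
    calc ENNReal.ofReal ρ * (ENNReal.ofReal c * ENNReal.ofReal (Real.sqrt ρ))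
        = ∫⁻ _ in Ioo (T - ρ) T, ENNReal.ofReal c * ENNReal.ofReal (Real.sqrt ρ) := by
          rw [setLIntegral_const, hvol, mul_comm]
      _ ≤ ∫⁻ s in Ioo (T - ρ) T, ENNReal.ofReal ρ * J s := lintegral_mono_ae hrate
      _ = ENNReal.ofReal ρ * ∫⁻ s in Ioo (T - ρ) T, J s :=
          lintegral_const_mul' _ _ ENNReal.ofReal_ne_top
  exact (ENNReal.mul_le_mul_iff_right (by simpa using hρ0) ENNReal.ofReal_ne_top).1 hint

/-! ### Leray's structure theorem from Leray's local regular `H¹` solutions -/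

section Structure

/-- **Fubini upgrade on a time slab** (slice-wise a.e. equality of measurable space–time fields
is space–time a.e. equality): if `u`, `v : ℝ → Y → F` have a.e.-strongly measurable uncurried
fields on `I × Y` (`I` a measurable set of times) and `u t = v t` a.e. for every `t ∈ I`, then
`uncurry u = uncurry v` a.e. on `I × Y` (strongly measurable representatives, whose coincidence
set is measurable; `Measure.ae_ae_of_ae_prod`, `Measure.ae_prod_iff_ae_ae`). Twin, for a general
time set, of the strip lemma used for Kato solutions. [folklore] -/
theorem uncurry_ae_eq_restrict_prod_of_forall_slice_ae_eq {Y F : Type*} [MeasureSpace Y]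
    [SFinite (volume : Measure Y)] [TopologicalSpace F] [MetrizableSpace F] {I : Set ℝ}
    (hI : MeasurableSet I) {u v : ℝ → Y → F} (huv : ∀ t ∈ I, u t =ᵐ[volume] v t)
    (hu : AEStronglyMeasurable (uncurry u) (volume.restrict (I ×ˢ (univ : Set Y))))
    (hv : AEStronglyMeasurable (uncurry v) (volume.restrict (I ×ˢ (univ : Set Y)))) :
    uncurry u =ᵐ[volume.restrict (I ×ˢ (univ : Set Y))] uncurry v := by
  have hprod : ((volume : Measure (ℝ × Y)).restrict (I ×ˢ univ)) =
      ((volume : Measure ℝ).restrict I).prod (volume : Measure Y) := by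
    rw [Measure.volume_eq_prod, ← Measure.restrict_univ (μ := (volume : Measure Y)),
      Measure.prod_restrict, Measure.restrict_univ]
  rw [hprod] at hu hv ⊢
  set μ := (volume : Measure ℝ).restrict I
  have huv' : ∀ᵐ t ∂μ, u t =ᵐ[volume] v t := by
    filter_upwards [ae_restrict_mem hI] with t ht using huv t ht
  obtain ⟨U, hUm, h1⟩ : ∃ U : ℝ × Y → F, StronglyMeasurable U ∧ uncurry u =ᵐ[μ.prod volume] U :=
    ⟨_, hu.stronglyMeasurable_mk, hu.ae_eq_mk⟩
  obtain ⟨V, hVm, h2⟩ : ∃ V : ℝ × Y → F, StronglyMeasurable V ∧ uncurry v =ᵐ[μ.prod volume] V :=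
    ⟨_, hv.stronglyMeasurable_mk, hv.ae_eq_mk⟩
  have h1' : ∀ᵐ a ∂μ, ∀ᵐ b ∂(volume : Measure Y), uncurry u (a, b) = U (a, b) :=
    Measure.ae_ae_of_ae_prod h1
  have h2' : ∀ᵐ a ∂μ, ∀ᵐ b ∂(volume : Measure Y), uncurry v (a, b) = V (a, b) :=
    Measure.ae_ae_of_ae_prod h2
  have h4 : ∀ᵐ a ∂μ, ∀ᵐ b ∂(volume : Measure Y), U (a, b) = V (a, b) := by
    filter_upwards [h1', h2', huv'] with a ha hb hc
    filter_upwards [ha, hb, hc] with b hxa hxb hxc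
    rw [← hxa, ← hxb]
    exact hxc
  have hmeas : MeasurableSet {z : ℝ × Y | U z = V z} := hUm.measurableSet_eq_fun hVm
  have h5 : U =ᵐ[μ.prod volume] V := (Measure.ae_prod_iff_ae_ae hmeas).2 h4
  exact h1.trans (h5.trans h2.symm)

/-- **Leray's structure theorem from Leray's local regular solutions** (Leray 1934, §33, p. 244,
the paragraph before the Théorème de structure: "le théorème d'unicité que nous venons d'établir a
dès lors la conséquence suivante …"; Robinson–Rodrigo–Sadowski 2016, proof of Lemma 6.11, PDF
p. 108, and Lemma 8.4). Leray's structure theorem in the form of the module docstring (the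
hypothesis of `scheffer_singular_times_of_leray_structure`) holds with constant `c` for every
Leray–Hopf solution as soon as `LerayLocalRegularH1With c` (the content of the accepted leaf
`leray_local_regular_H1`: Leray 1934, §§19–24; Ożański–Pooley 2018, Thm. 6.30 and Cor. 6.16):
at a.e. time `s` the solution restarts as a Leray–Hopf solution from
`u(s)` (`Fluid.IsLerayHopfOn.ae_isLerayHopfOn_restart`) and `u(s)` has the measurable weak gradient
`G(s)` (`Fluid.IsLerayHopfOn.exists_measurable_weakGradient`), so `‖∇u(s)‖² ≤ J²(s)`; if
`(t - s) J(s)⁴ < c ν³`, Leray's local regular solution `v` from `u(s)` lives past `t - s`, is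
bounded on `[δ, T'] × ℝ³`, and coincides with `u(· + s)` a.e. at every time by the proved
weak–strong uniqueness theorem `serrin_weak_strong_uniqueness_holds` (`v` is `H¹`-continuous,
hence in `L^∞_t L⁶_x`, `memLqLp_top_six_of_isH1RegularOn_Icc`); the slice-wise coincidence is
space–time a.e. on a slab around `t` (`uncurry_ae_eq_restrict_prod_of_forall_slice_ae_eq`), which
bounds `u` essentially on a parabolic cylinder about every `(t, x)`. Real proof. [cite: Leray1934, §33 p. 244] -/
theorem LerayLocalRegularH1With.leray_structure {c : ℝ} (hloc : LerayLocalRegularH1With c)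
    {ν T₀ : ℝ} (hν : 0 < ν) (_hT₀ : 0 < T₀) {u₀ : (EuclideanSpace ℝ (Fin 3)) → (EuclideanSpace ℝ (Fin 3))} {u : ℝ → (EuclideanSpace ℝ (Fin 3)) → (EuclideanSpace ℝ (Fin 3))}
    (hu : FluidPDE.IsLerayHopfOn T₀ ν 0 u₀ u) :
    ∃ G : ℝ → (EuclideanSpace ℝ (Fin 3)) → (EuclideanSpace ℝ (Fin 3)) →L[ℝ] (EuclideanSpace ℝ (Fin 3)),
      (∀ᵐ t ∂(volume.restrict (Ioo 0 T₀)), FluidPDE.HasWeakGradient (u t) (G t)) ∧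
      (∫⁻ t in Ioo 0 T₀, ∫⁻ x, ENNReal.ofReal (FluidPDE.frobeniusNormSq (G t x)) < ∞) ∧
      ∀ᵐ t' ∂(volume.restrict (Ioo 0 T₀)), ∀ t ∈ Ioo t' T₀,
        ENNReal.ofReal (t - t') *
            (∫⁻ x, ENNReal.ofReal (FluidPDE.frobeniusNormSq (G t' x))) ^ 2 <
              ENNReal.ofReal (c * ν ^ 3) →
          ∀ x : (EuclideanSpace ℝ (Fin 3)), FluidPDE.IsRegularPoint u (t, x) := by
  obtain ⟨G, -, hG, hGint, -⟩ := hu.exists_measurable_weakGradient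
  refine ⟨G, hG, hGint, ?_⟩
  filter_upwards [hu.ae_isLerayHopfOn_restart hν.le, hG, ae_restrict_mem measurableSet_Ioo]
    with s hLHs hGs hs
  intro t ht hlt x
  -- Leray's `J²(s)` is finite, `= A`
  set J : ℝ≥0∞ := ∫⁻ y, ENNReal.ofReal (FluidPDE.frobeniusNormSq (G s y)) with hJdef
  have hts : 0 < t - s := sub_pos.2 ht.1
  have hts0 : ENNReal.ofReal (t - s) ≠ 0 := by simpa using hts
  have hJtop : J ≠ ∞ := by
    intro hJ
    rw [hJ, ENNReal.top_pow two_ne_zero, ENNReal.mul_top hts0] at hlt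
    exact not_top_lt hlt
  set A : ℝ := J.toReal with hAdef
  have hA : 0 ≤ A := ENNReal.toReal_nonneg
  have hJA : J = ENNReal.ofReal A := (ENNReal.ofReal_toReal hJtop).symm
  have hcν : 0 < c * ν ^ 3 := by
    by_contra hle
    rw [ENNReal.ofReal_of_nonpos (not_lt.1 hle)] at hlt
    exact ENNReal.not_lt_zero hlt
  have hreal : (t - s) * A ^ 2 < c * ν ^ 3 := by
    rw [hJA, ← ENNReal.ofReal_pow hA, ← ENNReal.ofReal_mul hts.le] at hlt
    exact (ENNReal.ofReal_lt_ofReal_iff hcν).1 hlt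
  -- a lifespan `T'` with `t - s < T' ≤ T₀ - s` and `A² T' ≤ c ν³`
  set ε : ℝ := c * ν ^ 3 - (t - s) * A ^ 2 with hεdef
  have hε : 0 < ε := sub_pos.2 hreal
  set T₁ : ℝ := (t - s) + ε / (A ^ 2 + 1) with hT₁def
  have hT₁c : A ^ 2 * T₁ ≤ c * ν ^ 3 := by
    have h1 : A ^ 2 * (ε / (A ^ 2 + 1)) ≤ ε := by
      rw [mul_div_assoc', div_le_iff₀ (by positivity)]
      nlinarith [hε.le, sq_nonneg A]
    calc A ^ 2 * T₁ = (t - s) * A ^ 2 + A ^ 2 * (ε / (A ^ 2 + 1)) := by rw [hT₁def]; ring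
      _ ≤ (t - s) * A ^ 2 + ε := by linarith
      _ = c * ν ^ 3 := by rw [hεdef]; ring
  have htT₁ : t - s < T₁ := lt_add_of_pos_right _ (by positivity)
  set T' : ℝ := min T₁ (T₀ - s) with hT'def
  have htT' : t - s < T' := lt_min htT₁ (by linarith [ht.2])
  have hT' : 0 < T' := hts.trans htT'
  have hT'c : A ^ 2 * T' ≤ c * ν ^ 3 :=
    (mul_le_mul_of_nonneg_left (min_le_left _ _) (sq_nonneg A)).trans hT₁c
  have hT'le : T' ≤ T₀ - s := min_le_right _ _
  -- Leray's local regular solution from the state `u(s)`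
  have hu2 : MemLp (u s) 2 volume := hu.memLp s ⟨hs.1.le, hs.2.le⟩
  have hdiv : FluidPDE.IsWeaklyDivFree (u s) := hLHs.isWeaklyDivFree_datum (sub_pos.2 hs.2)
  have hgrad : FluidPDE.eWeakGradL2Sq (u s) ≤ ENNReal.ofReal A := by
    rw [← hJA]
    exact iInf₂_le (G s) hGs
  obtain ⟨v, p, hv, -, hvreg, hcl, hbounds⟩ := hloc hν hT' hu2 hdiv hA hgrad hT'c
  -- weak–strong uniqueness on `(0, T']`: `u (τ + s) = v τ` a.e. for every `τ`
  have hLHs' : FluidPDE.IsLerayHopfOn T' ν 0 (u s) (fun τ => u (τ + s)) := hLHs.of_le hT'le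
  have hS : FluidPDE.MemLqLp ∞ 6 v (Ioo 0 T') :=
    memLqLp_top_six_of_isH1RegularOn_Icc hvreg fun τ hτ => hv.memLp τ hτ
  have hqr : 2 / (∞ : ℝ≥0∞) + 3 / 6 ≤ 1 := by
    rw [ENNReal.div_top, zero_add]
    exact ENNReal.div_le_of_le_mul (by norm_num)
  have hae : ∀ τ ∈ Ioc 0 T', (fun τ => u (τ + s)) τ =ᵐ[volume] v τ :=
    serrin_weak_strong_uniqueness_holds hν hT' hv hu2 (q := ∞) (r := 6) (by norm_num) hqr hS
      hLHs'
  -- a radius `r` with `[t - r², t + r²] ⊂ (s, s + T')`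
  set m : ℝ := min (t - s) (s + T' - t) with hmdef
  have hm : 0 < m := lt_min hts (by linarith)
  set r : ℝ := min (1 / 2) (m / 2) with hrdef
  have hr : 0 < r := by positivity
  have hr2 : r ^ 2 < m := by
    have h1 : r ≤ 1 / 2 := min_le_left _ _
    have h2 : r ≤ m / 2 := min_le_right _ _
    nlinarith [hr.le]
  have hlow : s < t - r ^ 2 := by linarith [min_le_left (t - s) (s + T' - t)]
  have hup : t + r ^ 2 < s + T' := by linarith [min_le_right (t - s) (s + T' - t)]
  -- the bound on `v` on `[δ, T'] × ℝ³`, `δ = t - r² - s`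
  set δ : ℝ := t - r ^ 2 - s with hδdef
  have hδ0 : 0 < δ := by linarith
  have hδT : δ ≤ T' := by linarith [sq_nonneg r]
  obtain ⟨-, -, hvb, -⟩ := hbounds δ hδ0 hδT
  obtain ⟨C, hC⟩ := hvb 0
  -- `u = v(· - s)` a.e. on the slab `(t - r², t + r²) × ℝ³`, hence `‖u‖ ≤ C` a.e. there
  set I : Set ℝ := Ioo (t - r ^ 2) (t + r ^ 2) with hIdef
  have hI0 : I ⊆ Ioo 0 T₀ := Ioo_subset_Ioo (by linarith [hs.1]) (by linarith [hT'le])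
  have hmeas_u : AEStronglyMeasurable (uncurry u) (volume.restrict (I ×ˢ (univ : Set (EuclideanSpace ℝ (Fin 3))))) :=
    hu.weak.1.mono_measure (Measure.restrict_mono (prod_mono hI0 Subset.rfl) le_rfl)
  have hmaps : MapsTo (fun z : ℝ × (EuclideanSpace ℝ (Fin 3)) => (z.1 - s, z.2)) (I ×ˢ (univ : Set (EuclideanSpace ℝ (Fin 3))))
      (Ioc 0 T' ×ˢ (univ : Set (EuclideanSpace ℝ (Fin 3)))) := fun z hz =>
    ⟨⟨by linarith [hz.1.1], by linarith [hz.1.2]⟩, mem_univ _⟩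
  have hmeas_w : AEStronglyMeasurable (uncurry fun τ => v (τ - s))
      (volume.restrict (I ×ˢ (univ : Set (EuclideanSpace ℝ (Fin 3))))) := by
    have hcont : ContinuousOn (uncurry v) (Ioc 0 T' ×ˢ (univ : Set (EuclideanSpace ℝ (Fin 3)))) :=
      hcl.smooth_velocity.continuousOn
    have h2 : ContinuousOn (fun z : ℝ × (EuclideanSpace ℝ (Fin 3)) => uncurry v (z.1 - s, z.2)) (I ×ˢ (univ : Set (EuclideanSpace ℝ (Fin 3)))) :=
      hcont.comp ((continuous_fst.sub continuous_const).prodMk continuous_snd).continuousOn hmaps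
    exact h2.aestronglyMeasurable (measurableSet_Ioo.prod MeasurableSet.univ)
  have hslice : ∀ τ ∈ I, u τ =ᵐ[volume] (fun τ => v (τ - s)) τ := by
    intro τ hτ
    have h1 := hae (τ - s) ⟨by linarith [hτ.1], by linarith [hτ.2]⟩
    simpa only [sub_add_cancel] using h1
  have haeI := uncurry_ae_eq_restrict_prod_of_forall_slice_ae_eq measurableSet_Ioo hslice
    hmeas_u hmeas_w
  have hbound : ∀ᵐ z ∂(volume.restrict (I ×ˢ (univ : Set (EuclideanSpace ℝ (Fin 3))))), ‖u z.1 z.2‖ ≤ C := by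
    filter_upwards [haeI, ae_restrict_mem (measurableSet_Ioo.prod MeasurableSet.univ)]
      with z hz hzI
    have h1 : ‖v (z.1 - s) z.2‖ ≤ C := by
      have h := hC (z.1 - s) ⟨by linarith [hzI.1.1], by linarith [hzI.1.2]⟩ z.2
      rwa [norm_iteratedFDeriv_zero] at h
    have h2 : u z.1 z.2 = v (z.1 - s) z.2 := hz
    rw [h2]
    exact h1
  -- conclusion: `(t, x)` is a regular point (the cylinder `Q*_r(t, x)` lies in the slab)
  refine ⟨r, hr, ?_⟩
  rw [eLpNorm_exponent_top]
  refine eLpNormEssSup_lt_top_of_ae_bound (C := C) ?_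
  have hsub : FluidPDE.parabolicCylinderCentered r ((t, x) : ℝ × (EuclideanSpace ℝ (Fin 3))) ⊆ I ×ˢ (univ : Set (EuclideanSpace ℝ (Fin 3))) :=
    prod_mono Subset.rfl (subset_univ _)
  filter_upwards [ae_restrict_of_ae_restrict_of_subset hsub hbound] with z hz
  exact hz

/-- **Scheffer's theorem from Leray's local regular `H¹` solutions**: the accepted
`scheffer_singular_times` (ns.S28) follows from the accepted leaf `leray_local_regular_H1`
(Leray 1934, §§19–24) — composition of `LerayLocalRegularH1With.leray_structure`
(Leray 1934, §33) and `scheffer_singular_times_of_leray_structure` (Leray 1934, §34, (6.5);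
Scheffer 1976; Robinson–Rodrigo–Sadowski 2016, Thm. 8.14). Real proof. [cite: Leray1934, §§33–34] -/
theorem scheffer_singular_times_of_leray_local_regular_H1 (h : leray_local_regular_H1) :
    scheffer_singular_times := by
  obtain ⟨c, hc, hloc⟩ := h
  exact scheffer_singular_times_of_leray_structure hc fun hν hT₀ _ _ hu =>
    hloc.leray_structure hν hT₀ hu

end Structure

end Literature.Analysis.FluidPDE
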